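import Summits.Ventures.HodgeRepro2.HeckeCompositionNormalizer
import Summits.Ventures.HodgeRepro2.AtkinLehnerEigenvalues

/-!
# `T_α ∘ T_β = T_{βα}` on the Petersson space, for `β` normalising `S`

The function-level identity of `HeckeCompositionNormalizer.lean` descends to the Petersson space
`L²_k(S)` (rows 122 / 126: `heckeFamilyOf`), where the Hecke operators are honest linear maps:
for `β ∈ U(H)(K)` normalising `S` and any `α ∈ U(H)(K)`,

  `heckeFamilyOf … α ∘ heckeFamilyOf … β = heckeFamilyOf … (β * α)`.

Consequences: a normalising involution `w` (e.g. `diag(−1, 1, −1)` for the antidiagonal form,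
`AntidiagonalInvolution.lean`) gives `T_{wα} = T_α ∘ T_w`; when moreover `T_α` is self-adjoint and
commutes with `T_w`, the eigenforms of `T_α` split into the `±1`-eigenspaces of `T_w`.
-/

namespace Summit.Ventures.HodgeRepro2.ShimuraData

open Matrix

variable {K : Type*} [Field K] [NumberField K] [NumberField.IsCMField K] {τ₁ : K →+* ℂ}
  {H : Matrix (Fin 3) (Fin 3) K} {Q : Matrix (Fin 3) (Fin 3) ℂ}

/-- `heckeFamilyOf` on the class of a form is the class of `heckeForms` applied to it. -/
theorem heckeFamilyOf_mk (hQ : IsFrame K τ₁ H Q) (S : Subgroup (GL (Fin 3) K))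
    (hS : (S : Set (GL (Fin 3) K)) ⊆ (unitaryGroup K H : Set (GL (Fin 3) K)))
    [CompactSpace (ballQuotient hQ S hS)] {D : Set ball₂} (k : ℕ)
    (hD : IsBallFundamentalDomain hQ S hS D) (hDm : MeasurableSet D)
    (inst : (δ : unitaryGroup K H) → Fintype (S ⧸ (heckeSubgroup S δ).subgroupOf S))
    (δ : unitaryGroup K H) (f : PeterssonForms hQ S hS k hD) :
    heckeFamilyOf hQ S hS k hD hDm inst δ (SeparationQuotient.mk f) =
      SeparationQuotient.mk (@heckeForms K _ _ _ τ₁ H Q hQ S hS _ D k hD δ δ.property (inst δ) f) := by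
  unfold heckeFamilyOf
  letI : Fintype (S ⧸ (heckeSubgroup S (δ : GL (Fin 3) K)).subgroupOf S) := inst δ
  letI : Fintype (S ⧸ (heckeSubgroup S (δ : GL (Fin 3) K)⁻¹).subgroupOf S) := inst δ⁻¹
  exact heckeSpace_mk hQ S hS k hD δ.property hDm f

/-- **`T_α ∘ T_β = T_{βα}` on the Petersson space for `β` normalising `S`.** -/
theorem heckeFamilyOf_heckeFamilyOf_eq_of_normalizes (hQ : IsFrame K τ₁ H Q)
    (S : Subgroup (GL (Fin 3) K))
    (hS : (S : Set (GL (Fin 3) K)) ⊆ (unitaryGroup K H : Set (GL (Fin 3) K)))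
    [CompactSpace (ballQuotient hQ S hS)] {D : Set ball₂} (k : ℕ)
    (hD : IsBallFundamentalDomain hQ S hS D) (hDm : MeasurableSet D)
    (inst : (δ : unitaryGroup K H) → Fintype (S ⧸ (heckeSubgroup S δ).subgroupOf S))
    {β α : unitaryGroup K H} (hβ : ∀ s : GL (Fin 3) K, s ∈ S ↔ (β : GL (Fin 3) K) * s * (β : GL (Fin 3) K)⁻¹ ∈ S)
    (v : PeterssonSpace hQ S hS k hD) :
    heckeFamilyOf hQ S hS k hD hDm inst α (heckeFamilyOf hQ S hS k hD hDm inst β v) =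
      heckeFamilyOf hQ S hS k hD hDm inst (β * α) v := by
  obtain ⟨f, rfl⟩ := SeparationQuotient.surjective_mk v
  letI := inst α
  letI := inst β
  letI := inst (β * α)
  rw [heckeFamilyOf_mk, heckeFamilyOf_mk, heckeFamilyOf_mk, PeterssonSpace.mk_eq_mk_iff]
  intro z hz
  rw [heckeForms_apply_coe, heckeForms_apply_coe, heckeForms_apply_coe]
  have hf : IsWeightFor τ₁ Q S k ((PeterssonForms.toForm hQ S hS k hD f : weightForms τ₁ Q S k) :
      (Fin 2 → ℂ) → ℂ) :=
    ((mem_weightForms τ₁ Q S k).mp (PeterssonForms.toForm hQ S hS k hD f).property).1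
  exact hecke_hecke_eq_hecke_mul_of_normalizes hQ hS hβ β.property α.property hf hz

/-- The linear-map form: `T_α ∘ₗ T_β = T_{βα}`. -/
theorem heckeFamilyOf_comp_of_normalizes (hQ : IsFrame K τ₁ H Q) (S : Subgroup (GL (Fin 3) K))
    (hS : (S : Set (GL (Fin 3) K)) ⊆ (unitaryGroup K H : Set (GL (Fin 3) K)))
    [CompactSpace (ballQuotient hQ S hS)] {D : Set ball₂} (k : ℕ)
    (hD : IsBallFundamentalDomain hQ S hS D) (hDm : MeasurableSet D)
    (inst : (δ : unitaryGroup K H) → Fintype (S ⧸ (heckeSubgroup S δ).subgroupOf S))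
    {β α : unitaryGroup K H} (hβ : ∀ s : GL (Fin 3) K, s ∈ S ↔ (β : GL (Fin 3) K) * s * (β : GL (Fin 3) K)⁻¹ ∈ S) :
    heckeFamilyOf hQ S hS k hD hDm inst α ∘ₗ heckeFamilyOf hQ S hS k hD hDm inst β =
      heckeFamilyOf hQ S hS k hD hDm inst (β * α) :=
  LinearMap.ext fun v => heckeFamilyOf_heckeFamilyOf_eq_of_normalizes hQ S hS k hD hDm inst hβ v

/-- **Eigenforms of `T_α` commuting with a normalising involution `T_w` split by the sign of
`T_w`**: if `w` normalises `S`, `w² = 1`, and `T_α` commutes with `T_w` on `v`, then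
`v₊ := v + T_w v` and `v₋ := v − T_w v` are `T_w`-eigenvectors of eigenvalues `+1` / `−1` with
`v = (v₊ + v₋)/2`, and if `v` is a `T_α`-eigenvector so are `v₊` and `v₋` (same eigenvalue). -/
theorem eigenvector_split_of_normalizes_of_sq_eq_one (hQ : IsFrame K τ₁ H Q)
    (S : Subgroup (GL (Fin 3) K))
    (hS : (S : Set (GL (Fin 3) K)) ⊆ (unitaryGroup K H : Set (GL (Fin 3) K)))
    [CompactSpace (ballQuotient hQ S hS)] {D : Set ball₂} (k : ℕ)
    (hD : IsBallFundamentalDomain hQ S hS D) (hDm : MeasurableSet D)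
    (inst : (δ : unitaryGroup K H) → Fintype (S ⧸ (heckeSubgroup S δ).subgroupOf S))
    {w α : unitaryGroup K H} (hw : ∀ s : GL (Fin 3) K, s ∈ S ↔ (w : GL (Fin 3) K) * s * (w : GL (Fin 3) K)⁻¹ ∈ S)
    (hww : (w : GL (Fin 3) K) * w = 1) {v : PeterssonSpace hQ S hS k hD} {μ : ℂ}
    (hv : heckeFamilyOf hQ S hS k hD hDm inst α v = μ • v)
    (hcomm : heckeFamilyOf hQ S hS k hD hDm inst α (heckeFamilyOf hQ S hS k hD hDm inst w v) =
      heckeFamilyOf hQ S hS k hD hDm inst w (heckeFamilyOf hQ S hS k hD hDm inst α v)) :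
    let Tw := heckeFamilyOf hQ S hS k hD hDm inst w
    let Tα := heckeFamilyOf hQ S hS k hD hDm inst α
    Tw (v + Tw v) = v + Tw v ∧ Tw (v - Tw v) = -(v - Tw v) ∧
      Tα (v + Tw v) = μ • (v + Tw v) ∧ Tα (v - Tw v) = μ • (v - Tw v) ∧
      (2 : ℂ)⁻¹ • ((v + Tw v) + (v - Tw v)) = v := by
  intro Tw Tα
  have hTT : ∀ x, Tw (Tw x) = x := fun x =>
    heckeFamilyOf_heckeFamilyOf_eq_self_of_normalizes_of_sq_eq_one hQ S hS k hD hDm inst hw hww x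
  refine ⟨?_, ?_, ?_, ?_, ?_⟩
  · rw [map_add, hTT, add_comm]
  · rw [map_sub, hTT, neg_sub]
  · rw [map_add, hv, hcomm, hv, map_smul, smul_add]
  · rw [map_sub, hv, hcomm, hv, map_smul, smul_sub]
  · rw [add_add_sub_cancel, ← two_smul ℂ v, smul_smul, inv_mul_cancel₀ two_ne_zero, one_smul]

end Summit.Ventures.HodgeRepro2.ShimuraData
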